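import Summits.RiemannHypothesis.RiemannHypothesis.Theorems.PfPersistenceGapClassG1

/-!
# PF persistence — the ALIGNED CLASS: guess-alignment U-readings are certified G1-cont members
(pub-rhpf CAND SEAT 1 gen 2, `planner-pub-rhpf-cand-1-g2-0`)

**HONEST FRAMING. This is a long-odds MECHANISM SEARCH; no RH claims.** Labels PROVED / TYPED / DATA as in
`PfPersistenceAdmissibleClass.lean` / `PfPersistenceGapClassG1.lean`. Nothing in this file bears on RH: it certifies the
SHAPE of a family of all-window criteria (membership in the typer's class `InG1cont`), never whether `ζ` satisfies one.

The cell's CAND SEAT 1 readers (harness ids `cand1-001` GUESS-ALIGN, `cand1-004`, `cand1-008`; GAP-CLASSES rows C1-I1,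
C1-L2) test, window by window, whether the ground state `u₁` of the even block is ALIGNED with a fixed WINDOW-ONLY unit
vector — Connes' corrected prolate guess `k̂(a, N)` (pub-weilobs SCHEMA §3.1; a definition request, NOT formalised here).
This file types the criterion over an ABSTRACT guess family `g` (one vector per window) and PROVES:

* §1 `WindowAligned g δ₀ M`: no Euclidean-unit vector with alignment defect `1 − |⟨w, g⟩| ≥ δ₀` is a ground state of the
  form of `M` (each is strictly beaten in Rayleigh value by some unit vector) — an eigenvector-free phrasing; PROVED
  `WindowAligned.alignDefect_lt`: every Rayleigh minimiser over the unit sphere then has defect `< δ₀`.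
* §2 PROVED `isOpen_setOf_windowAligned`: alignment is an OPEN condition on matrices (compactness of the set of
  misaligned unit vectors + joint continuity of `(M, v) ↦ vᵀMv`, the pattern of `isOpen_setOf_windowStrictlyPositive`).
* §3 `alignedClassOn R g δ₀` (aligned at every window of the regime `R`), PROVED window-wise open
  (`isWindowwiseOpen_alignedClassOn`), inhabited by the rank-one datum `−g gᵀ` (`negProjDatum_mem_alignedClassOn`,
  `g` unit, `0 < δ₀`), NON-LOCAL AT EVERY HEIGHT when `R` has windows of dimension `≥ 2` above every height and
  `δ₀ ≤ 1/4` (`nonlocalAtEveryHeight_alignedClassOn`; exit: the zero matrix, at which a coordinate vector is a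
  misaligned ground state), hence the **MEMBERSHIP CERTIFICATE** `inG1cont_alignedClassOn` (clause (4) of G1 via the
  typer's `inG1cont_of`): the alignment U-readings are G1-cont members for EVERY guess family — W1–W4 do not close
  them as a class; their RH-strength is decided member-wise (ADJ A15: 'structural separation, ζ-relative').
* §3b PROVED: ALIGNMENT and POSITIVITY are INCOMPARABLE as classes — `alignedClassOn_not_subset_positiveClass`
  (the member `−g gᵀ` is negative) and `strictPositiveClass_not_subset_alignedClassOn` (the identity datum is strictly
  positive and misaligned: `one_not_windowAligned`); the alignment readers are `ζ`-relative structural criteria, not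
  positivity tests (ADJ A15, now formal at the class level).
* §4 TYPED only: `ZetaAlignedOn R g δ₀ := zetaDatum ∈ alignedClassOn R g δ₀` — with `g = k̂` and `δ₀ = 10⁻³` on
  `R = {a ≥ 0.3}` this is the U-ALIGN reading. DATA (official harness run `cand1-001`, two engines): `ζ` holds it on
  477/477 served windows (`a ∈ [0.3, 1.96]`, `N ∈ [40, 600]`, defect `10^{−3.4} … 10^{−10.9}`, law `≈ 10^{−3.2}·λ^{−7.4}`,
  ALGEBRAIC in `λ` — a thermometer-class quantity, cf. `PfPersistenceM2FloorTransfer`); every other served object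
  violates it at some window; per window it is UNSOUND for positivity (21 fine-dial witness windows one grid step past
  their sign flip — the dial lemma, `PfPersistenceDialSpaceLeaf`). No implication with RH is known in either direction.
-/

set_option linter.dupNamespace false  -- the mandated namespace repeats `RiemannHypothesis`

noncomputable section

open Real Finset Matrix Filter Topology

namespace Summit.RiemannHypothesis.RiemannHypothesis.Theorems.PfPersistence

/-! ## §1 Alignment of the ground states with a guess vector, eigenvector-free -/

/-- the ALIGNMENT DEFECT `1 − |⟨w, g⟩|` of `w` against the guess `g` (sign-blind; `= 1 − |cos ∠(w, g)|` for unit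
vectors; the harness reader reports its `log₁₀`). [folklore] -/
def alignDefect {n : ℕ} (w g : Fin n → ℝ) : ℝ := 1 - |w ⬝ᵥ g|

/-- `M` is `δ₀`-ALIGNED with `g`: every Euclidean-unit vector whose alignment defect is `≥ δ₀` is strictly beaten in
Rayleigh value by some unit vector — i.e. no `δ₀`-misaligned vector is a ground state of the form `v ↦ vᵀMv`. [folklore] -/
def WindowAligned {n : ℕ} (g : Fin n → ℝ) (δ₀ : ℝ) (M : Matrix (Fin n) (Fin n) ℝ) : Prop :=
  ∀ w : Fin n → ℝ, w ⬝ᵥ w = 1 → δ₀ ≤ alignDefect w g →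
    ∃ v : Fin n → ℝ, v ⬝ᵥ v = 1 ∧ v ⬝ᵥ (M *ᵥ v) < w ⬝ᵥ (M *ᵥ w)

/-- PROVED: in a `δ₀`-aligned window every Rayleigh minimiser over the unit sphere (every ground state) has alignment
defect `< δ₀`. [folklore] -/
theorem WindowAligned.alignDefect_lt {n : ℕ} {g : Fin n → ℝ} {δ₀ : ℝ} {M : Matrix (Fin n) (Fin n) ℝ}
    (h : WindowAligned g δ₀ M) {w : Fin n → ℝ} (hw : w ⬝ᵥ w = 1)
    (hmin : ∀ v : Fin n → ℝ, v ⬝ᵥ v = 1 → w ⬝ᵥ (M *ᵥ w) ≤ v ⬝ᵥ (M *ᵥ v)) : alignDefect w g < δ₀ := by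
  by_contra hc
  obtain ⟨v, hv, hlt⟩ := h w hw (not_lt.1 hc)
  exact absurd (hmin v hv) (not_le.2 hlt)

/-- a Euclidean-unit vector has every coordinate of modulus `≤ 1`. [folklore] -/
theorem abs_apply_le_one_of_dotProduct_self_eq_one {n : ℕ} {w : Fin n → ℝ} (hw : w ⬝ᵥ w = 1) (i : Fin n) :
    |w i| ≤ 1 := by
  have h1 : w i * w i ≤ ∑ j, w j * w j :=
    Finset.single_le_sum (f := fun j => w j * w j) (fun j _ => mul_self_nonneg (w j)) (Finset.mem_univ i)
  have h2 : ∑ j, w j * w j = 1 := hw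
  exact abs_le_one_iff_mul_self_le_one.2 (h2 ▸ h1)

/-- the set of `δ₀`-MISALIGNED Euclidean-unit vectors is compact. [folklore] -/
theorem isCompact_misaligned {n : ℕ} (g : Fin n → ℝ) (δ₀ : ℝ) :
    IsCompact {w : Fin n → ℝ | w ⬝ᵥ w = 1 ∧ δ₀ ≤ alignDefect w g} := by
  have hc1 : Continuous fun w : Fin n → ℝ => w ⬝ᵥ w := continuous_id.dotProduct continuous_id
  have hc2 : Continuous fun w : Fin n → ℝ => alignDefect w g :=
    continuous_const.sub (continuous_id.dotProduct continuous_const).abs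
  have hcl : IsClosed {w : Fin n → ℝ | w ⬝ᵥ w = 1 ∧ δ₀ ≤ alignDefect w g} :=
    (isClosed_eq hc1 continuous_const).inter (isClosed_le continuous_const hc2)
  refine (isCompact_closedBall (0 : Fin n → ℝ) 1).of_isClosed_subset hcl ?_
  rintro w ⟨hw, -⟩
  rw [Metric.mem_closedBall, dist_zero_right, pi_norm_le_iff_of_nonneg zero_le_one]
  intro i
  rw [Real.norm_eq_abs]
  exact abs_apply_le_one_of_dotProduct_self_eq_one hw i

/-! ## §2 Alignment is an open condition on matrices -/

/-- PROVED: `δ₀`-alignment with `g` is OPEN in the matrix (compact set of misaligned unit vectors; joint continuity of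
`(M, v) ↦ vᵀMv`). [folklore] -/
theorem isOpen_setOf_windowAligned {n : ℕ} (g : Fin n → ℝ) (δ₀ : ℝ) :
    IsOpen {M : Matrix (Fin n) (Fin n) ℝ | WindowAligned g δ₀ M} := by
  rw [isOpen_iff_eventually]
  intro M₀ hM₀
  have hq : Continuous fun z : Matrix (Fin n) (Fin n) ℝ × (Fin n → ℝ) => z.2 ⬝ᵥ (z.1 *ᵥ z.2) :=
    continuous_snd.dotProduct (continuous_fst.matrix_mulVec continuous_snd)
  have hK := isCompact_misaligned g δ₀
  have h1 : ∀ w ∈ {w : Fin n → ℝ | w ⬝ᵥ w = 1 ∧ δ₀ ≤ alignDefect w g},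
      ∀ᶠ z : Matrix (Fin n) (Fin n) ℝ × (Fin n → ℝ) in 𝓝 (M₀, w),
        ∃ v : Fin n → ℝ, v ⬝ᵥ v = 1 ∧ v ⬝ᵥ (z.1 *ᵥ v) < z.2 ⬝ᵥ (z.1 *ᵥ z.2) := by
    rintro w ⟨hw, hδ⟩
    obtain ⟨v, hv, hlt⟩ := hM₀ w hw hδ
    have hv' : Continuous fun z : Matrix (Fin n) (Fin n) ℝ × (Fin n → ℝ) => v ⬝ᵥ (z.1 *ᵥ v) :=
      continuous_const.dotProduct (continuous_fst.matrix_mulVec continuous_const)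
    have hF : Continuous fun z : Matrix (Fin n) (Fin n) ℝ × (Fin n → ℝ) =>
        z.2 ⬝ᵥ (z.1 *ᵥ z.2) - v ⬝ᵥ (z.1 *ᵥ v) := hq.sub hv'
    have h0 : 0 < (M₀, w).2 ⬝ᵥ ((M₀, w).1 *ᵥ (M₀, w).2) - v ⬝ᵥ ((M₀, w).1 *ᵥ v) := sub_pos.2 hlt
    exact ((hF.tendsto (M₀, w)).eventually (lt_mem_nhds h0)).mono fun z hz => ⟨v, hv, sub_pos.1 hz⟩
  have h2 := hK.eventually_forall_of_forall_eventually
    (P := fun M w => ∃ v : Fin n → ℝ, v ⬝ᵥ v = 1 ∧ v ⬝ᵥ (M *ᵥ v) < w ⬝ᵥ (M *ᵥ w)) h1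
  exact h2.mono fun M hM w hw hδ => hM w ⟨hw, hδ⟩

/-! ## §3 The aligned class on a regime of windows: a certified G1-cont member -/

/-- a GUESS FAMILY: one vector per window (intended instance: Connes' corrected prolate guess `k̂(a, N)`, pub-weilobs
SCHEMA §3.1 — a definition request; this file never uses its construction). [folklore] -/
abbrev GuessFamily : Type := (win : Window) → (Fin (win.N + 1) → ℝ)

/-- the ALIGNED CLASS on the regime `R`: data whose every window in `R` is `δ₀`-aligned with the guess (windows
outside `R` unconstrained; `R = Set.univ` is the all-window reading). [folklore] -/
def alignedClassOn (R : Set Window) (g : GuessFamily) (δ₀ : ℝ) : Set Datum :=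
  {d | ∀ win ∈ R, WindowAligned (g win) δ₀ (d win)}

/-- PROVED: the aligned class is window-wise open (clause (1) of G1). [folklore] -/
theorem isWindowwiseOpen_alignedClassOn (R : Set Window) (g : GuessFamily) (δ₀ : ℝ) :
    IsWindowwiseOpen (alignedClassOn R g δ₀) := by
  classical
  refine ⟨fun win => {M | win ∈ R → WindowAligned (g win) δ₀ M}, fun win => ?_, ?_⟩
  · by_cases h : win ∈ R
    · simpa [h] using isOpen_setOf_windowAligned (g win) δ₀
    · simp [h]
  · ext d
    simp [alignedClassOn]

/-- Rayleigh value of the rank-one matrix `g gᵀ`: `wᵀ(g gᵀ)w = ⟨w, g⟩²`. [folklore] -/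
theorem dotProduct_vecMulVec_mulVec {n : ℕ} (g w : Fin n → ℝ) :
    w ⬝ᵥ (vecMulVec g g *ᵥ w) = (w ⬝ᵥ g) * (w ⬝ᵥ g) := by
  have h : vecMulVec g g *ᵥ w = (g ⬝ᵥ w) • g := by
    ext i
    simp [Matrix.mulVec, dotProduct, vecMulVec_apply, Finset.mul_sum, mul_comm, mul_left_comm]
  rw [h, dotProduct_smul, smul_eq_mul, dotProduct_comm g w]

/-- the rank-one datum `−g gᵀ` (ground state `g` itself at every window). [folklore] -/
def negProjDatum (g : GuessFamily) : Datum := fun win => -vecMulVec (g win) (g win)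

/-- PROVED: `−g gᵀ` is `δ₀`-aligned with `g` for unit `g` and `0 < δ₀` (a misaligned unit `w` has `|⟨w, g⟩| < 1`, so
`wᵀMw = −⟨w, g⟩² > −1 = gᵀMg`). [folklore] -/
theorem windowAligned_negVecMulVec {n : ℕ} {g : Fin n → ℝ} (hg : g ⬝ᵥ g = 1) {δ₀ : ℝ} (hδ : 0 < δ₀) :
    WindowAligned g δ₀ (-vecMulVec g g) := by
  intro w _ hw
  refine ⟨g, hg, ?_⟩
  rw [Matrix.neg_mulVec, Matrix.neg_mulVec, dotProduct_neg, dotProduct_neg, dotProduct_vecMulVec_mulVec,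
    dotProduct_vecMulVec_mulVec, hg, neg_lt_neg_iff, one_mul]
  have h1 : |w ⬝ᵥ g| < 1 := by
    unfold alignDefect at hw
    linarith
  have h2 : (w ⬝ᵥ g) ^ 2 < 1 := (sq_lt_one_iff_abs_lt_one _).2 h1
  rw [pow_two] at h2
  exact h2

/-- PROVED: the rank-one datum inhabits the aligned class (unit guess family, `0 < δ₀`). [folklore] -/
theorem negProjDatum_mem_alignedClassOn (R : Set Window) {g : GuessFamily} (hg : ∀ win, g win ⬝ᵥ g win = 1)
    {δ₀ : ℝ} (hδ : 0 < δ₀) : negProjDatum g ∈ alignedClassOn R g δ₀ :=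
  fun win _ => windowAligned_negVecMulVec (hg win) hδ

/-- PROVED (exit lemma): in dimension `≥ 2` a matrix whose Rayleigh value is CONSTANT on the unit sphere (every unit
vector a ground state: `0`, `1`, `c • 1`) is not `δ₀`-aligned with a unit `g` when `δ₀ ≤ 1/4`: some coordinate vector
`eᵢ` has `gᵢ² ≤ 1/2`, hence defect `≥ 1 − √½ > 1/4`, and nothing beats it strictly. [folklore] -/
theorem not_windowAligned_of_rayleigh_const {n : ℕ} (hn : 2 ≤ n) {g : Fin n → ℝ} (hg : g ⬝ᵥ g = 1) {δ₀ : ℝ}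
    (hδ : δ₀ ≤ 1 / 4) {M : Matrix (Fin n) (Fin n) ℝ}
    (hM : ∀ v w : Fin n → ℝ, v ⬝ᵥ v = 1 → w ⬝ᵥ w = 1 → v ⬝ᵥ (M *ᵥ v) = w ⬝ᵥ (M *ᵥ w)) :
    ¬ WindowAligned g δ₀ M := by
  classical
  intro h
  set i0 : Fin n := ⟨0, by omega⟩ with hi0
  set i1 : Fin n := ⟨1, by omega⟩ with hi1
  have hne : i0 ≠ i1 := by simp [hi0, hi1, Fin.ext_iff]
  have hsum : g i0 * g i0 + g i1 * g i1 ≤ 1 := by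
    have hsub : ({i0, i1} : Finset (Fin n)) ⊆ Finset.univ := Finset.subset_univ _
    have hle := Finset.sum_le_sum_of_subset_of_nonneg hsub
      (f := fun j => g j * g j) (fun j _ _ => mul_self_nonneg (g j))
    rw [Finset.sum_pair hne] at hle
    have : ∑ j, g j * g j = 1 := hg
    linarith
  -- one of the two coordinates is small
  obtain ⟨i, hi⟩ : ∃ i : Fin n, g i * g i ≤ 1 / 2 := by
    by_cases h0 : g i0 * g i0 ≤ 1 / 2
    · exact ⟨i0, h0⟩
    · exact ⟨i1, by linarith [not_le.1 h0]⟩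
  have habs : |g i| ≤ 3 / 4 :=
    abs_le.2 ⟨by nlinarith [hi, sq_nonneg (g i + 3 / 4)], by nlinarith [hi, sq_nonneg (g i - 3 / 4)]⟩
  have hw1 : (Pi.single i 1 : Fin n → ℝ) ⬝ᵥ Pi.single i 1 = 1 := by simp
  have hwd : δ₀ ≤ alignDefect (Pi.single i 1 : Fin n → ℝ) g := by
    unfold alignDefect
    rw [single_dotProduct, one_mul]
    linarith
  obtain ⟨v, hv, hlt⟩ := h (Pi.single i 1) hw1 hwd
  exact hlt.ne (hM v _ hv hw1)

/-- PROVED (exit matrix): the ZERO matrix is not `δ₀`-aligned (dimension `≥ 2`, unit `g`, `δ₀ ≤ 1/4`). [folklore] -/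
theorem zero_not_windowAligned {n : ℕ} (hn : 2 ≤ n) {g : Fin n → ℝ} (hg : g ⬝ᵥ g = 1) {δ₀ : ℝ}
    (hδ : δ₀ ≤ 1 / 4) : ¬ WindowAligned g δ₀ (0 : Matrix (Fin n) (Fin n) ℝ) :=
  not_windowAligned_of_rayleigh_const hn hg hδ fun v w _ _ => by simp [Matrix.zero_mulVec]

/-- PROVED: the IDENTITY matrix is not `δ₀`-aligned (dimension `≥ 2`, unit `g`, `δ₀ ≤ 1/4`): strictly positive yet
misaligned — positivity does not force alignment. [folklore] -/
theorem one_not_windowAligned {n : ℕ} (hn : 2 ≤ n) {g : Fin n → ℝ} (hg : g ⬝ᵥ g = 1) {δ₀ : ℝ}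
    (hδ : δ₀ ≤ 1 / 4) : ¬ WindowAligned g δ₀ (1 : Matrix (Fin n) (Fin n) ℝ) :=
  not_windowAligned_of_rayleigh_const hn hg hδ fun v w hv hw => by rw [Matrix.one_mulVec, Matrix.one_mulVec, hv, hw]

/-- a window of height `> A` and dimension `2` (`N = 1`). [folklore] -/
def windowAbove₂ (A : ℝ) : Window := ⟨max A 0 + 1, 1, by positivity⟩

/-- `windowAbove₂ A` is not below `A`. [folklore] -/
theorem windowAbove₂_not_mem_below (A : ℝ) : windowAbove₂ A ∉ below A :=
  not_le.2 ((le_max_left A 0).trans_lt (lt_add_one _))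

/-- a regime is TALL: it contains windows of dimension `≥ 2` above every height (e.g. `{win | a₀ ≤ win.a}`, or
`Set.univ`). [folklore] -/
def TallRegime (R : Set Window) : Prop := ∀ A : ℝ, ∃ win ∈ R, A < win.a ∧ 1 ≤ win.N

/-- PROVED: `Set.univ` is tall. [folklore] -/
theorem tallRegime_univ : TallRegime Set.univ := fun A =>
  ⟨windowAbove₂ A, Set.mem_univ _, (le_max_left A 0).trans_lt (lt_add_one _), le_refl _⟩

/-- PROVED: the floor regime `{a₀ ≤ a}` is tall. [folklore] -/
theorem tallRegime_floor (a₀ : ℝ) : TallRegime {win | a₀ ≤ win.a} := fun A =>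
  ⟨⟨max (max A a₀) 0 + 1, 1, by positivity⟩,
    ((le_max_right A a₀).trans (le_max_left _ 0)).trans (le_add_of_nonneg_right zero_le_one),
    ((le_max_left A a₀).trans (le_max_left _ 0)).trans_lt (lt_add_one _), le_refl _⟩

/-- PROVED: on a tall regime the aligned class is NON-LOCAL AT EVERY HEIGHT (clause (2) of G1; exit: replace the
rank-one member by the zero matrix at one window of dimension `≥ 2` above `A`). [folklore] -/
theorem nonlocalAtEveryHeight_alignedClassOn {R : Set Window} (hR : TallRegime R) {g : GuessFamily}
    (hg : ∀ win, g win ⬝ᵥ g win = 1) {δ₀ : ℝ} (hδ : 0 < δ₀) (hδ' : δ₀ ≤ 1 / 4) :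
    NonlocalAtEveryHeight (alignedClassOn R g δ₀) := by
  classical
  intro A
  obtain ⟨win₀, hwin₀R, hA, hN⟩ := hR A
  have hnot : win₀ ∉ below A := not_le.2 hA
  refine not_determinedOn_of_exit (negProjDatum_mem_alignedClassOn R hg hδ) ?_ hnot
    (d := Function.update (negProjDatum g) win₀ 0) fun win hwin => by simp [hwin]
  intro hd
  have h0 := hd win₀ hwin₀R
  rw [Function.update_self] at h0
  exact zero_not_windowAligned (by omega) (hg win₀) hδ' h0

/-- **PROVED — MEMBERSHIP CERTIFICATE: the aligned class is a G1-cont member** (clause (4) via `inG1cont_of`), for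
EVERY unit guess family `g`, every `δ₀ ∈ (0, 1/4]` and every tall regime. The walls W1–W4 do not close it as a class;
its RH-strength is decided member-wise (ADJ A15: structural, `ζ`-relative). [folklore] -/
theorem inG1cont_alignedClassOn {R : Set Window} (hR : TallRegime R) {g : GuessFamily}
    (hg : ∀ win, g win ⬝ᵥ g win = 1) {δ₀ : ℝ} (hδ : 0 < δ₀) (hδ' : δ₀ ≤ 1 / 4) :
    InG1cont (alignedClassOn R g δ₀) :=
  inG1cont_of (isWindowwiseOpen_alignedClassOn R g δ₀) (nonlocalAtEveryHeight_alignedClassOn hR hg hδ hδ')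

/-- PROVED: in particular the all-window aligned class is G1-cont. [folklore] -/
theorem inG1cont_alignedClass_univ {g : GuessFamily} (hg : ∀ win, g win ⬝ᵥ g win = 1) {δ₀ : ℝ} (hδ : 0 < δ₀)
    (hδ' : δ₀ ≤ 1 / 4) : InG1cont (alignedClassOn Set.univ g δ₀) :=
  inG1cont_alignedClassOn tallRegime_univ hg hδ hδ'

/-! ## §3b Alignment and positivity are INCOMPARABLE as classes (ADJ A15 'structural, ζ-relative', formally) -/

/-- PROVED: the rank-one member `−g gᵀ` is NOT in the positive class (`gᵀ(−g gᵀ)g = −1`): alignment does not force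
positivity. [folklore] -/
theorem negProjDatum_not_mem_positiveClass {g : GuessFamily} (hg : ∀ win, g win ⬝ᵥ g win = 1) :
    negProjDatum g ∉ positiveClass := by
  intro h
  have h1 := h (windowAbove₂ 0) (g (windowAbove₂ 0))
  rw [negProjDatum, Matrix.neg_mulVec, dotProduct_neg, dotProduct_vecMulVec_mulVec, hg] at h1
  norm_num at h1

/-- PROVED: the aligned class is not contained in the positive class (any regime, unit `g`, `0 < δ₀`). [folklore] -/
theorem alignedClassOn_not_subset_positiveClass (R : Set Window) {g : GuessFamily}
    (hg : ∀ win, g win ⬝ᵥ g win = 1) {δ₀ : ℝ} (hδ : 0 < δ₀) : ¬ (alignedClassOn R g δ₀ ⊆ positiveClass) :=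
  fun h => negProjDatum_not_mem_positiveClass hg (h (negProjDatum_mem_alignedClassOn R hg hδ))

/-- PROVED: the identity datum (strictly positive, `oneDatum_mem_strictPositiveClass`) is NOT aligned on a tall regime
(`δ₀ ≤ 1/4`): strict positivity does not force alignment. [folklore] -/
theorem oneDatum_not_mem_alignedClassOn {R : Set Window} (hR : TallRegime R) {g : GuessFamily}
    (hg : ∀ win, g win ⬝ᵥ g win = 1) {δ₀ : ℝ} (hδ : δ₀ ≤ 1 / 4) : oneDatum ∉ alignedClassOn R g δ₀ := by
  intro h
  obtain ⟨win₀, hwin₀R, -, hN⟩ := hR 0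
  exact one_not_windowAligned (by omega) (hg win₀) hδ (h win₀ hwin₀R)

/-- PROVED: the strictly positive class `P⁺` is not contained in the aligned class (tall regime, `δ₀ ≤ 1/4`). Together
with `alignedClassOn_not_subset_positiveClass`: ALIGNMENT and POSITIVITY are incomparable G1-cont members — the
alignment readers are `ζ`-relative structural criteria, not positivity tests (ADJ A15). [folklore] -/
theorem strictPositiveClass_not_subset_alignedClassOn {R : Set Window} (hR : TallRegime R) {g : GuessFamily}
    (hg : ∀ win, g win ⬝ᵥ g win = 1) {δ₀ : ℝ} (hδ : δ₀ ≤ 1 / 4) : ¬ (strictPositiveClass ⊆ alignedClassOn R g δ₀) :=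
  fun h => oneDatum_not_mem_alignedClassOn hR hg hδ (h oneDatum_mem_strictPositiveClass)

/-! ## §4 The U-ALIGN reading of `ζ` (TYPED only; DATA in the module docstring) -/

/-- TYPED (U-ALIGN): `ζ`'s even blocks are `δ₀`-aligned with the guess family on the regime `R`. With `g` = Connes'
corrected prolate guess `k̂(a, N)` (definition request), `δ₀ = 10⁻³`, `R = {0.3 ≤ a}`: DATA 477/477 served windows
(harness `cand1-001`, two engines; defect law `≈ 10^{−3.2}·λ^{−7.4}`, algebraic). UNSOUND for positivity per window
(21 fine-dial witnesses); no implication with RH known in either direction (ADJ A15 label). [folklore] -/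
def ZetaAlignedOn (R : Set Window) (g : GuessFamily) (δ₀ : ℝ) : Prop := zetaDatum ∈ alignedClassOn R g δ₀

/-- PROVED (bookkeeping): the U-ALIGN reading at a window forces every ground state of `ζ`'s block there to have
alignment defect `< δ₀`. [folklore] -/
theorem ZetaAlignedOn.alignDefect_lt {R : Set Window} {g : GuessFamily} {δ₀ : ℝ} (h : ZetaAlignedOn R g δ₀)
    {win : Window} (hwin : win ∈ R) {w : Fin (win.N + 1) → ℝ} (hw : w ⬝ᵥ w = 1)
    (hmin : ∀ v : Fin (win.N + 1) → ℝ, v ⬝ᵥ v = 1 → w ⬝ᵥ (zetaDatum win *ᵥ w) ≤ v ⬝ᵥ (zetaDatum win *ᵥ v)) :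
    alignDefect w (g win) < δ₀ :=
  (h win hwin).alignDefect_lt hw hmin

end Summit.RiemannHypothesis.RiemannHypothesis.Theorems.PfPersistence

end
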